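import Summits.QuantumFields.BalabanUV.T4Continuum.Spine.NE1p.DressedSmallFieldComponentCount
import Summits.QuantumFields.BalabanUV.T4Continuum.Spine.NE1p.DressedSmallFieldInnerLink
import Summits.QuantumFields.BalabanUV.T4Continuum.Spine.NE1p.DressedSmallFieldFamiliesWitness
import Summits.QuantumFields.BalabanUV.T4Continuum.Spine.NE1p.DressedSmallFieldInnerLabelsWitness

/-!
# T⁴ programme, spine estimate NE1′ (node O3b/H2) — WITNESS «THE ANCHORED COMPONENT SUM FIRES»: the owner's N0w END
# `attachedPart_locE_le_of_coresAt_pencil_components` (`Spine/NE1p/DressedSmallFieldComponentCount`) APPLIED ONCE BY NAME — a decided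
# applier — on pv22's torus read at both scales as the SAME torus, with the outer-label ∕ component index of the unit cube ENUMERATED

Cell `pub-balaban`, sub-cell `t4`, row NE1′ formalisation crew (`t4/formal/NE1p/LEAVES.md` row W53 ∕ DAG N29zzx; INTENT HOME/CLAIMS.log l.20082,
BOOKED-AHEAD typer R-T127 l.20102; X171 its read), unit `b2b-balaban-t4-ne1p-formalise-leaf-10` (gen 11).  PART 1 of 2 (D1): toy DATA + the
clauses + the END; PART 2 `Spine/NE1p/DressedSmallFieldComponentsWitnessLive` (THEOREMS ONLY) enumerates the index and proves liveness.
ADDITIVE — imports the owner's N0w `Spine/NE1p/DressedSmallFieldComponentCount` (t4-ne1p-p1 g29; → N0v `DressedSmallFieldOuterCount` → N0u →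
N0t → N0s; b13's `Literature/…/B13FamilySum` in its cone), the crew's S40.1 `Spine/NE1p/DressedSmallFieldInnerLink` (leaf-07 g16; the (2.27)-link
on the torus), W45 `Spine/NE1p/DressedSmallFieldFamiliesWitness` (leaf-10 g10; → W41 → W35 → W33 → W24, row NE5's `Support/B13HistWitness`) and
W50.1 `Spine/NE1p/DressedSmallFieldInnerLabelsWitness` (leaf-06 g11; its numeral `RI` and its two finite-set facts BY NAME) ONLY; toy DATA `def`s + one type `abbrev` + theorems; 0 `def … : Prop`, 0 cite, 0 sorry, 0 `attribute`; nothing of N0w ∕ N0v ∕ N0u ∕ N0s ∕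
S40.1 ∕ W45 ∕ W41 ∕ W35 ∕ W33 ∕ W24 ∕ row NE5 ∕ b13 ∕ pv22 is restated — `attachedPart_locE_le_of_coresAt_pencil_components`, `link_torus'`,
`RI`, `coveringFamilies_emptyFootprint`, `powerset_unitCube`, `δF`, `κF`, `α₆F`, `hκ_F`, `h229_F_eq`, `hsmall_F`, `coveringFamilies_unitCube`, `coreW`, `liveTable`, `E1`, `ctr0`, `hroom0`, `Acst`, `cM`,
`letterMass_coreW`, `budget_half`, `dj_X₀`, `X₀`, `hrate_torus`, `torus_consts`, `K₀_four`, `coveringFamilies`, `tgeometry`, `tsys` are used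
BY NAME.

WHY.  N0w puts the LAST geometric step of [Balaban1988RGII]'s (B3)-count in kernel on the cell's format: N0v's outer-label END (uncovered
cubes `W′ = Z∖Z′₀` × covering families `{Z′_i}` × one inner datum per member) with the member's inner datum typed as a scale-`k` COMPONENT
`Z₀` with `cl Z₀ = Z′_i` carrying one of its inner labels, the per-member bound `hmember` DISCHARGED by the anchored fibre sum
(`fibreSum_le_card_anchor_mul`, `memberSum_le_of_anchor`, `Gk.ineq126` BY NAME).  At landing N0w's END has no DECIDED applier: the
crew's S41 types its complement (component SETS, `hinner` supplied from N0u) and S44 its face on pv22's nested tori (`tclosureDom`,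
`ineq236With_torus`) — both GENERIC, on no datum.  This file inhabits N0w's binders on ONE decided datum, following the owner's own
non-vacuity hint (`README-N0w.md` (g): one component per closure, a one-cube anchor, a small inner label set):
* §1 THE RATES OF RECORD, EVERY CLAUSE MET WITH EQUALITY at OUR numerals over pv22's located letters (`κ₀ = 64 log 162`, `K₀(64,8)`, `c₁ = 64`):
  the outer rate = W50's `RI = 2κ₀ + 3` BY NAME (one unit above W24's `Rkp = 2κ₀ + 2`), the uncovered-cube letter `vC := e^{−5RI}∕64` (= W52's `vO` in value; BY NAME only if that module precedes this one in the tree) so that `c₁·(vC·e^{5RI}) = 1` and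
  N0w's rate bookkeeping `hRR` holds WITH EQUALITY (`hRR_C_eq`); `r := δF·κF = κ₀ + 1` (W45's `hκ_F`), `R₀C := 4κ₀ + 4` so that the split rate
  `hrate2 : r + R ≤ (R₀ − κ₀)·ℓ` holds WITH EQUALITY at `ℓ = 1` (`hrate2_C_eq` — the anchored `κ₀` CHARGED); the component amplitude
  `εC := α₆F∕(K₀(64,8)·e^{5RI})` so that N0w's (2.29) amplitude `ε·e^{c₀}·Aₐ·K₀·e^{5R}` at `c₀ = 0`, `Aₐ = 1` IS W45's `α₆F` and the clause
  `h229` IS W45's `h229_F_eq` (`h229_C_eq`, `= 1`, TIGHT); `εC ≤ ½`, `εC + vC ≤ 1`;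
* §2 THE ANCHOR AND THE INNER DATA: `anc₁ Z := {Z.2.1.choose}` — ONE cube of the domain (`IsTDom`'s non-emptiness; `hanchor` by
  `choose_spec` at the closure `cl := id`, `hA` at `Aₐ := 1`); `htransfer` at `ℓ := 1` by `one_mul`; inner labels `Bool` with
  `mC Z₀ b := ½·e^{−R₀C d(Z₀)}` — N0w's displayed `hinner` (N0u's currency) MET WITH EQUALITY as a two-summand sum (`hinner_C_eq`), BY CHOICE;
* §3 THE TERM INDEX OF RECORD: `JC Z′ := (univ.filter (· = Z′)).sigma fun _ => univ` — LITERALLY the inner finset N0w feeds to N0v at `cl = id`,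
  `I = univ` (`= {Z′} ×ˢ Bool`, `#JC = 2`); `termsC Z := (cubes Z).powerset.sigma fun W′ => (coveringFamilies univ cubes (cubes Z ∖ W′)).sigma
  fun F => F.pi JC` = ALL admissible outer labels with component inner data, so N0w's `hadm` holds WITH EQUALITY, its third clause in
  N0w's LITERAL shape (`hadm_C`, membership unpacking only);
* §4 THE LABEL-INDEXED CORES: `majC l := vC^{#W′}·Π_{x∈F.attach} εC·mC (p x).1 (p x).2` — N0w's table-blind majorant VERBATIM —, the
  uncovered label `⟨{0}, ⟨∅, –⟩⟩` weighs `vC > 0` (`majC_uncoveredLabel`, `_pos`: the `Z∖Z′₀` fibre is LIVE), each covered label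
  `⟨∅, ⟨{X₀}, X₀ ↦ ⟨X₀, b⟩⟩⟩` weighs `εC∕2` (`majC_coveredLabel`); one W33 core `coreW (cC l) r` per label at `cC l := (cM r∕2)·majC l`, so that
  `hAmp` holds for EVERY sub-polymer and EVERY label by W41's `budget_half` at `A₀ := 0`, `A₁ := A∕4`, `ϱ := 2` (`hAmp_C`); the activity of
  record `actC k s Z := Σ_{l ∈ termsC Z} (GC k l k).termAt 0 (0 + s • liveTable)` (`hact`∕`hscale` by `rfl`);
* §5 **`componentsEnd_fires`** — N0w's END ONCE BY NAME with `D = Dk := tsys 4 N`, `G = Gk := tgeometry 4 N`, `cl := fun Z => Z`, `anc := anc₁`,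
  `I := fun _ => univ`, `m := mC`, `(ε, c₀, R₀, Aₐ, ℓ, r, R, c′, v) := (εC, 0, R₀C, 1, 1, δF·κF, RI, 5, vC)`, W33's `ctr0`∕`hroom0`, NE5's toy letters
  `(mq, bq, N₀) = (1, 0, 1)` INLINE, W24's `hrate_torus`, W45's `hsmall_F`∕`hκ_F`, §1–§4's lemmas, and the (2.27)∘(2.37) LINK **`hlink := link_torus' 4 N`**
  SUPPLIED BY NAME from S40.1 (never restated); conclusion LITERAL; closed form `≤ K₀(64,8)` (`componentsEnd_fires_closed`).

WORDING OF RECORD (crew row W53 = DAG N29zzx, typer R-T127 (ii) (g)): «a DECIDED applier of N0w's END; `cl = id`, `ℓ = 1` — a SINGLE-SCALE toy: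
the L-blocking closure, the (2.36) transfer and the anchor count `(L+2)⁴` for Bałaban's domains are NOT modelled (pv22's `tclosureDom` ∕
`ineq236With_torus` are S44's GENERIC business, N0u's inner count composed into `hinner` is S41's); `hinner`∕`htransfer`∕`hanchor`∕`hA` are MET BY
CHOICE on the toy; (B3-amp) MET because the weights are CHOSEN as N0w's majorant — UNPRINTED for Bałaban's cores (G-ne9p2-5); (B3-count) =
N0w ∘ N0v ∘ N0s's kernel counts of b13's PROVED (2.29)∕(1.26)-type lemmas on pv22's CONSTRUCTED torus geometry, the link S40.1's theorem from
the Geometry FIELD (2.27); (B1b) NOT claimed».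

HONEST FRAMING.  A DECIDED TOY ([folklore] ∕ [decided toy] ∕ [arith] tags; 0 sorry; 0 citations — bracketed names are labels; no
`def … : Prop` — the `def`s are toy DATA, four numerals and one type abbreviation).  The cores are THEOREM-backed instances of the cell's typed
FORMAT of (2.14) (`B13TermParamGaussianBi.BiCore`) over row NE5's TOY measurable frame with NE5's DECOUPLED toy letters `N := 1`, `q := ‖v‖²`
— NOT Bałaban's (2.14) terms, NOT rows NE2∕NE3's Gaussian data, NOT the substrate's `slotsOfRecord`; «terms = all admissible labels»,
`ι₀ = Bool`, `cl = id`, `ℓ = 1`, the one-cube anchor, the weights and the numerals `4κ₀+4`, `e^{−5R}∕64`, `α₆F∕(K₀ e^{5R})`, `½`, `A∕4`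
are OUR toy choices over pv22's located letters; the `5` is (2.27)'s typed constant via S40.1 and N0v's displayed `(d+5)` shape; print's
`e^{−(κ₁−1)}`, «(L+2)⁴ cubes □′», «½Lκ», (1.28), (2.35)–(2.39) of [Balaban1988RGII] are TYPE∕CONTEXT only — no numeral of the audited
manuscript is asserted as a fact about Bałaban's densities; 0 binders instantiated on Bałaban's densities; no wall item; wall v1.7 (T4-DAG v46)
does NOT move; R-t4r2-Q2 NOT met thereby; NE1′ ⇐ the named binders — NOT proved, NOT printed; spine PROVED 0∕9; count 9 unchanged.  ABSOLUTE
RULE honoured (nothing internally minted is cited; `FlowStep.BetaPertH` ∕ (B) ∕ G-an2-4 appear in prose only).  Rung (B)+1 on ONE finite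
four-torus — NOT infinite volume, NOT a mass gap, NOT OS on ℝ⁴, NOT Clay.  HONEST DEPENDENCY: continuum YM on T⁴ ⇐ BetaPertH ∧ nine spine
estimates (0/9 proved); BetaPertH ⇐ (D1) ∧ (D4) ∧ CAP+tail; G-an2-4 gates asym, D1 and NE2/3/4.
-/

noncomputable section

namespace Summit.QuantumFields.BalabanUV.T4Continuum.NE1p.DressedSmallFieldComponentsWitness

open Set Metric MeasureTheory Complex
open scoped BigOperators
open Literature.MathematicalPhysics.QuantumFieldTheory.Balaban1983to89
open Literature.MathematicalPhysics.QuantumFieldTheory.Balaban1983to89.B12TreeDecay (K₀ K₀_pos kappa₀_nonneg)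
open Literature.MathematicalPhysics.QuantumFieldTheory.Balaban1983to89.B13Resummation (locE)
open Literature.MathematicalPhysics.QuantumFieldTheory.Balaban1983to89.B13FamilySum (coveringFamilies mem_coveringFamilies)
open Literature.MathematicalPhysics.QuantumFieldTheory.Balaban1983to89.TreeLengthTorus (TPt TDom tsys torusTreeLen)
open Literature.MathematicalPhysics.QuantumFieldTheory.Balaban1983to89.TreeLengthTorusGeometry (tgeometry TTouch)
open Summit.QuantumFields.BalabanUV.T4Continuum.B13HistMeasurable (B13HistM)
open Summit.QuantumFields.BalabanUV.T4Continuum.B13HistWitness (toyFrame)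
open Summit.QuantumFields.BalabanUV.T4Continuum.B13TermParamGaussianBi (BiCore)
open Summit.QuantumFields.BalabanUV.T4Continuum.NE1p.DressedSmallFieldTorusWitness (X₀ X₀_val eq_X₀_iff hrate_torus
  dressedConst_le_one exp_locE_cube)
open Summit.QuantumFields.BalabanUV.T4Continuum.NE1p.DressedSmallFieldGeometry (torus_consts)
open Summit.QuantumFields.BalabanUV.T4Continuum.NE1p.DressedSmallFieldGeometryFaces (K₀_four)
open Summit.QuantumFields.BalabanUV.T4Continuum.NE1p.DressedSmallFieldCoresWitness (E1 crd liveTable norm_liveTable_le coreW N₁_coreW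
  ctr0 hroom0 Acst Acst_pos incr integral_incr_pos)
open Summit.QuantumFields.BalabanUV.T4Continuum.NE1p.DressedSmallFieldCoresMassWitness (letterMass_coreW cM cM_pos)
open Summit.QuantumFields.BalabanUV.T4Continuum.NE1p.DressedSmallFieldDepCoresWitness (budget_half dj_X₀ termAt_coreW_pencil
  closedForm_real_sub_zero norm_term_le)
open Summit.QuantumFields.BalabanUV.T4Continuum.NE1p.DressedSmallFieldFamiliesWitness (δF κF α₆F α₆F_pos α₆F_le_one δF_mul_κF hκ_F
  h229_F_eq hsmall_F coveringFamilies_unitCube)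
open Summit.QuantumFields.BalabanUV.T4Continuum.NE1p.DressedSmallFieldInnerLink (link_torus')
open Summit.QuantumFields.BalabanUV.T4Continuum.NE1p.DressedSmallFieldInnerLabelsWitness (RI RI_pos coveringFamilies_emptyFootprint
  powerset_unitCube)
open Summit.QuantumFields.BalabanUV.T4Continuum.NE1p.DressedSmallFieldComponentCount (attachedPart_locE_le_of_coresAt_pencil_components)

section Torus
variable (N : ℕ) [NeZero N]

/-! ## §1 THE RATES OF RECORD, EVERY CLAUSE OF N0w MET WITH EQUALITY (OUR numerals over pv22's torus constants) -/

/-! The outer rate is W50's count rate `RI = 2κ₀ + 3` BY NAME (leaf-06 g11): ONE unit above W24's located per-polymer rate `Rkp = 2κ₀ + 2` —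
the room N0v∕N0w's rate bookkeeping `Rkp ≤ R − c₁·u` charges for the entropy of the uncovered cubes `Z∖Z′₀`. -/
/-- The inner rate `R₀ := 4κ₀ + 4` (toy numeral): `r + R = (R₀ − κ₀)·ℓ` at `r = κ₀ + 1`, `ℓ = 1` — N0w's `hrate2` WITH EQUALITY, the
anchored part `κ₀` of the rate CHARGED. [folklore] -/
def R₀C : ℝ := 4 * (tgeometry 4 N).κ₀ + 4
/-- The uncovered-cube letter `v := e^{−5R}∕64` (toy numeral; print's `e^{−(κ₁−1)}` per cube of `Z∖Z′₀`, (2.35), is TYPE only):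
`c₁·v·e^{5R} = 1` at pv22's `c₁ = 64`. [folklore] -/
def vC : ℝ := Real.exp (-(5 * RI N)) / 64
/-- The component amplitude `ε := α₆F ∕ (K₀(64,8)·e^{5R})` (toy numeral): N0w's (2.29) amplitude `ε·e^{c₀}·Aₐ·K₀·e^{5R}` at `c₀ = 0`,
`Aₐ = 1` IS W45's `α₆F`, so the clause `e·K₀·c₁·(…) ≤ 1` is W45's `h229_F_eq` (`= 1`, TIGHT). [folklore] -/
def εC : ℝ := α₆F / (K₀ 64 8 * Real.exp (5 * RI N))

/-- `3 ≤ R` (W50's `RI = 2κ₀ + 3`). [arith] -/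
theorem three_le_RI : 3 ≤ RI N := by unfold RI; linarith [(tgeometry 4 N).κ₀_nonneg]
/-- `0 < v`. [arith] -/
theorem vC_pos : 0 < vC N := by unfold vC; positivity
/-- `v ≤ 1∕64`. [arith] -/
theorem vC_le : vC N ≤ 1 / 64 := by
  unfold vC
  have h : Real.exp (-(5 * RI N)) ≤ 1 := Real.exp_le_one_iff.2 (by linarith [three_le_RI N])
  linarith
/-- `0 < ε`. [arith] -/
theorem εC_pos : 0 < εC N := by unfold εC; have := α₆F_pos; have := K₀_pos (64 : ℝ) 8; positivity
/-- **THE (2.29) AMPLITUDE IS `α₆F`**: `ε·e^{0}·1·K₀(64,8)·e^{5R} = α₆F`. [arith] -/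
theorem εC_amplitude : εC N * Real.exp 0 * 1 * K₀ 64 8 * Real.exp (5 * RI N) = α₆F := by
  unfold εC; rw [Real.exp_zero]; have := K₀_pos (64 : ℝ) 8; have := Real.exp_pos (5 * RI N); field_simp
/-- `ε ≤ 1∕2`: `K₀(64,8) ≥ 1∕81` and `e^{5R} ≥ e^{15} ≥ 6³`, so `K₀·e^{5R} ≥ 8∕3`, with `α₆F ≤ 1`. [arith] -/
theorem εC_le_half : εC N ≤ 1 / 2 := by
  unfold εC
  have hK : 1 / 81 ≤ K₀ (64 : ℝ) 8 := by
    unfold K₀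
    rw [show (((8 : ℕ) : ℝ) + 1) ^ 2 = 81 by norm_num]
    exact div_le_div_of_nonneg_right (Real.one_le_exp (kappa₀_nonneg (by norm_num) _)) (by norm_num)
  have h5 : (6 : ℝ) ≤ Real.exp 5 := by have h := Real.add_one_le_exp (5 : ℝ); norm_num at h ⊢; exact h
  have hE : (216 : ℝ) ≤ Real.exp (5 * RI N) := by
    calc (216 : ℝ) = 6 ^ 3 := by norm_num
      _ ≤ Real.exp 5 ^ 3 := by gcongr
      _ = Real.exp 15 := by rw [← Real.exp_nat_mul]; norm_num
      _ ≤ Real.exp (5 * RI N) := Real.exp_le_exp.2 (by linarith [three_le_RI N])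
  have hden : (8 : ℝ) / 3 ≤ K₀ 64 8 * Real.exp (5 * RI N) := by
    calc (8 : ℝ) / 3 = 1 / 81 * 216 := by norm_num
      _ ≤ K₀ 64 8 * Real.exp (5 * RI N) := mul_le_mul hK hE (by norm_num) (K₀_pos (64 : ℝ) 8).le
  rw [div_le_iff₀ (by linarith)]
  linarith [α₆F_le_one]
/-- `ε + v ≤ 1`. [arith] -/
theorem εC_add_vC_le_one : εC N + vC N ≤ 1 := by linarith [εC_le_half N, vC_le N]

/-- **THE UNCOVERED-CUBE ENTROPY COSTS EXACTLY ONE UNIT OF RATE**: `c₁·(v·e^{R·5}) = 1` (`c₁ = 64`, `torus_consts`). [arith] -/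
theorem c₁_mul_vC : (tgeometry 4 N).c₁ * (vC N * Real.exp (RI N * 5)) = 1 := by
  rw [(torus_consts N).2.2]; unfold vC
  rw [show RI N * 5 = 5 * RI N by ring, div_mul_eq_mul_div, ← Real.exp_add, neg_add_cancel, Real.exp_zero]; norm_num
/-- **N0w's RATE BOOKKEEPING `hRR` HOLDS WITH EQUALITY**: `Rkp = 2κ₀ + 2 = R − c₁·(v·e^{R·5}) = (2κ₀ + 3) − 1`. [arith] -/
theorem hRR_C_eq : 2 * (tgeometry 4 N).κ₀ + 2 = RI N - (tgeometry 4 N).c₁ * (vC N * Real.exp (RI N * 5)) := by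
  rw [c₁_mul_vC]; unfold RI; ring
/-- … N0w's binder `hRR` as typed (`≤`). [arith] -/
theorem hRR_C : 2 * (tgeometry 4 N).κ₀ + 2 ≤ RI N - (tgeometry 4 N).c₁ * (vC N * Real.exp (RI N * 5)) := (hRR_C_eq N).le
/-- **N0w's SPLIT RATE `hrate2` HOLDS WITH EQUALITY**: `r + R = (κ₀ + 1) + (2κ₀ + 3) = (R₀ − κ₀)·1` (`r = δF·κF = κ₀ + 1`, W45) — the
anchored part `κ₀` of the inner rate CHARGED (the owner's dev mutant M1 in datum form). [arith] -/
theorem hrate2_C_eq : δF * κF + RI N = (R₀C N - (tgeometry 4 N).κ₀) * 1 := by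
  rw [δF_mul_κF]; unfold RI R₀C; rw [(torus_consts N).2.1]; ring
/-- … N0w's binder `hrate2` as typed (`≤`). [arith] -/
theorem hrate2_C : δF * κF + RI N ≤ (R₀C N - (tgeometry 4 N).κ₀) * 1 := (hrate2_C_eq N).le
/-- N0w's `hκR`: `κ₀ ≤ R₀`. [arith] -/
theorem hκR_C : (tgeometry 4 N).κ₀ ≤ R₀C N := by unfold R₀C; linarith [(tgeometry 4 N).κ₀_nonneg]
/-- **N0w's (2.29) CLAUSE `h229` HOLDS WITH EQUALITY — it IS W45's `h229_F_eq`**: `e·K₀·c₁·(ε·e^{0}·1·K₀·e^{5R}) = e·K₀·c₁·α₆F = 1`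
(`K₀_four`). [arith] -/
theorem h229_C_eq : Real.exp 1 * (tgeometry 4 N).K₀ * (tgeometry 4 N).c₁ *
    (εC N * Real.exp 0 * 1 * (tgeometry 4 N).K₀ * Real.exp (5 * RI N)) = 1 := by
  have h := h229_F_eq N
  rw [K₀_four] at h
  rw [K₀_four, εC_amplitude]
  exact h
/-- … N0w's binder `h229` as typed (`≤ 1`). [arith] -/
theorem h229_C : Real.exp 1 * (tgeometry 4 N).K₀ * (tgeometry 4 N).c₁ *
    (εC N * Real.exp 0 * 1 * (tgeometry 4 N).K₀ * Real.exp (5 * RI N)) ≤ 1 := (h229_C_eq N).le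

/-! ## §2 THE ANCHOR AND THE INNER DATA OF A COMPONENT (toy DATA), N0w's `hanchor`∕`hA`∕`htransfer`∕`hinner` MET -/

/-- THE ANCHOR (toy DATA): ONE cube of the domain — its chosen point (`IsTDom`'s non-emptiness); print's «(L+2)⁴ cubes □′ from π_k touching
a fixed LM-cube in Z′_i» (p. 19–20) is TYPE only. [folklore] -/
def anc₁ (Z : TDom 4 N) : Finset (TPt 4 N) := {Z.2.1.choose}
/-- `#anc = 1`. [folklore] -/
theorem anc₁_card (Z : TDom 4 N) : (anc₁ N Z).card = 1 := Finset.card_singleton _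
/-- **N0w's `hanchor` MET** at the closure `cl := id`: the one component with closure `Z′` is `Z′` itself, and it contains its chosen cube. [folklore] -/
theorem hanchor_C : ∀ Z₀ Z' : TDom 4 N, (fun Z : TDom 4 N => Z) Z₀ = Z' → ∃ c ∈ anc₁ N Z', c ∈ (tgeometry 4 N).cubes Z₀ := by
  rintro Z₀ Z' rfl
  exact ⟨Z₀.2.1.choose, Finset.mem_singleton_self _, Z₀.2.1.choose_spec⟩
/-- **N0w's `hA` MET** at `Aₐ := 1`. [folklore] -/
theorem hA_C : ∀ Z' : TDom 4 N, ((anc₁ N Z').card : ℝ) ≤ 1 := fun Z' => by rw [anc₁_card]; norm_num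
/-- **N0w's (2.36)-KIND TRANSFER `htransfer` MET** at `cl := id`, `ℓ := 1` (the toy reads both scales as the same torus; the L-blocking
closure `tclosureDom` of pv22 is NOT modelled). [folklore] -/
theorem htransfer_C : ∀ Z₀ Z' : TDom 4 N, (fun Z : TDom 4 N => Z) Z₀ = Z' → 1 * (tsys 4 N).dj Z' ≤ (tsys 4 N).dj Z₀ := by
  rintro Z₀ Z' rfl; rw [one_mul]

/-- THE INNER WEIGHTS OF A COMPONENT (toy DATA): two inner labels `b ∈ Bool`, each carrying HALF of N0u's currency
`e^{c₀}·e^{−R₀ d_k(Z₀)}` at `c₀ := 0` — N0w's displayed `hinner` MET WITH EQUALITY BY CHOICE (NOT supplied from N0u's inner count: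
that composition is S41's). [folklore] -/
def mC (Z₀ : TDom 4 N) (_b : Bool) : ℝ := 1 / 2 * Real.exp (-(R₀C N * (tsys 4 N).dj Z₀))
/-- `0 ≤ m`. [arith] -/
theorem mC_nonneg : ∀ (Z₀ : TDom 4 N) (b : Bool), 0 ≤ mC N Z₀ b := fun Z₀ b => by unfold mC; positivity
/-- **N0w's `hinner` HOLDS WITH EQUALITY** as a two-summand sum over `I := univ : Finset Bool`. [arith] -/
theorem hinner_C_eq (Z₀ : TDom 4 N) : ∑ b ∈ (Finset.univ : Finset Bool), mC N Z₀ b =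
    Real.exp 0 * Real.exp (-(R₀C N * (tsys 4 N).dj Z₀)) := by
  unfold mC
  rw [Finset.sum_const, Finset.card_univ, Fintype.card_bool, Real.exp_zero, one_mul, nsmul_eq_mul]
  ring
/-- … N0w's binder `hinner` as typed (`≤`). [arith] -/
theorem hinner_C : ∀ Z₀ : TDom 4 N, ∑ b ∈ (Finset.univ : Finset Bool), mC N Z₀ b ≤
    Real.exp 0 * Real.exp (-(R₀C N * (tsys 4 N).dj Z₀)) := fun Z₀ => (hinner_C_eq N Z₀).le

/-! ## §3 THE TERM INDEX OF RECORD (toy DATA): ALL admissible outer labels with component inner data — N0w's `hadm` WITH EQUALITY -/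

/-- The outer labels with component inner data: `⟨W′, ⟨F, p⟩⟩`, `p Z′ _ = ⟨Z₀, b⟩` (N0w's index type at `ι₀ := Bool`). [folklore] -/
abbrev LabelC := Σ _ : Finset (TPt 4 N), Σ F : Finset (TDom 4 N), ∀ Z' ∈ F, (Σ _ : TDom 4 N, Bool)

open Classical in
/-- N0w's inner finsets at `cl := id`, `I := univ`: `J Z′ := (univ.filter (· = Z′)).sigma fun _ => univ` — LITERALLY the `J` N0w feeds to
N0v's END. [folklore] -/
def JC (Z' : TDom 4 N) : Finset (Σ _ : TDom 4 N, Bool) :=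
  ((Finset.univ : Finset (TDom 4 N)).filter (fun Z₀ => (fun Z : TDom 4 N => Z) Z₀ = Z')).sigma fun _ => Finset.univ

open Classical in
/-- `J Z′` is the closure fibre `{Z′}` times `Bool`. [folklore] -/
theorem JC_eq (Z' : TDom 4 N) : JC N Z' = ({Z'} : Finset (TDom 4 N)).sigma fun _ => Finset.univ := by
  ext j
  simp only [JC, Finset.mem_sigma, Finset.mem_filter, Finset.mem_univ, true_and, Finset.mem_singleton]

open Classical in
/-- `#J Z′ = 2`. [folklore] -/
theorem JC_card (Z' : TDom 4 N) : (JC N Z').card = 2 := by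
  rw [JC_eq, Finset.card_sigma, Finset.sum_singleton, Finset.card_univ, Fintype.card_bool]

open Classical in
/-- THE TERM INDEXING OF RECORD (toy DATA): the terms of a polymer `Z` are ALL admissible outer labels — `W′ ⊆ cubes Z`, `F` a covering
family of `cubes Z ∖ W′` from the whole torus catalogue, `p ∈ F.pi J` — N0w's `hadm` WITH EQUALITY (the admissible set of N0v's
`fibredCount_le` ∘ `familyPi_count_le` itself). [folklore] -/
def termsC (Z : TDom 4 N) : Finset (LabelC N) :=
  ((tgeometry 4 N).cubes Z).powerset.sigma fun W =>
    (coveringFamilies (Finset.univ : Finset (TDom 4 N)) (tgeometry 4 N).cubes ((tgeometry 4 N).cubes Z \ W)).sigma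
      fun F => F.pi (JC N)

open Classical in
/-- **N0w's `hadm` MET** (membership unpacking; the third clause in N0w's LITERAL shape). [folklore] -/
theorem hadm_C : ∀ Z : TDom 4 N, ∀ l ∈ termsC N Z, l.1 ⊆ (tgeometry 4 N).cubes Z ∧
    l.2.1 ∈ coveringFamilies Finset.univ (tgeometry 4 N).cubes ((tgeometry 4 N).cubes Z \ l.1) ∧
    ∀ Z' (h : Z' ∈ l.2.1), l.2.2 Z' h ∈
      ((Finset.univ : Finset (TDom 4 N)).filter (fun Z₀ => (fun Z : TDom 4 N => Z) Z₀ = Z')).sigma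
        (fun _ => (Finset.univ : Finset Bool)) := by
  intro Z l hl
  unfold termsC at hl
  obtain ⟨hW, hF⟩ := Finset.mem_sigma.1 hl
  obtain ⟨hF1, hp⟩ := Finset.mem_sigma.1 hF
  exact ⟨Finset.mem_powerset.1 hW, hF1, fun Z' h => Finset.mem_pi.1 hp Z' h⟩

/-! ## §4 THE LABEL-INDEXED CORES (toy DATA): one W33 core per outer label, weighted by N0w's majorant -/

/-- N0w's table-blind majorant of a label (toy DATA): `v^{#W′}·Π_{Z′∈F} ε·m (p Z′).1 (p Z′).2` — LITERALLY the shape in N0w's `hAmp`. [folklore] -/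
def majC (l : LabelC N) : ℝ := vC N ^ l.1.card * ∏ x ∈ l.2.1.attach, (εC N * mC N (l.2.2 x.1 x.2).1 (l.2.2 x.1 x.2).2)
/-- `0 ≤ maj`. [arith] -/
theorem majC_nonneg (l : LabelC N) : 0 ≤ majC N l :=
  mul_nonneg (pow_nonneg (vC_pos N).le _) (Finset.prod_nonneg fun _ _ => mul_nonneg (εC_pos N).le (mC_nonneg N _ _))

/-- THE UNCOVERED LABEL `⟨{0}, ⟨∅, –⟩⟩` (everything of `X₀` outside `Z′₀`; the empty family, the empty choice). [folklore] -/
def uncoveredLabel : LabelC N := ⟨{0}, ⟨∅, fun Z' h => absurd h (Finset.notMem_empty Z')⟩⟩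
/-- THE COVERED LABELS `⟨∅, ⟨{X₀}, X₀ ↦ ⟨X₀, b⟩⟩⟩`, `b ∈ Bool` (the singleton family, the component `X₀` itself, inner label `b`). [folklore] -/
def coveredLabel (b : Bool) : LabelC N := ⟨∅, ⟨{X₀ N}, fun _ _ => ⟨X₀ N, b⟩⟩⟩

/-- **THE `Z∖Z′₀` FIBRE IS LIVE**: the uncovered label weighs `v > 0` (`#W′ = 1`, empty product) — `v := 0` would kill N0v's fourth step on
the datum. [folklore] -/
theorem majC_uncoveredLabel : majC N (uncoveredLabel N) = vC N := by
  unfold majC uncoveredLabel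
  rw [Finset.card_singleton, pow_one, Finset.attach_empty, Finset.prod_empty, mul_one]
/-- `0 < maj (uncovered label)`. [folklore] -/
theorem majC_uncoveredLabel_pos : 0 < majC N (uncoveredLabel N) := by rw [majC_uncoveredLabel]; exact vC_pos N
/-- Each covered label weighs `ε∕2` (`#W′ = 0`, one member `X₀` of tree length `0`, half the inner currency). [folklore] -/
theorem majC_coveredLabel (b : Bool) : majC N (coveredLabel N b) = εC N / 2 := by
  unfold majC coveredLabel
  rw [Finset.card_empty, pow_zero, one_mul, Finset.prod_attach {X₀ N} (fun _ => εC N * mC N (X₀ N) b), Finset.prod_singleton]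
  unfold mC
  rw [dj_X₀, mul_zero, neg_zero, Real.exp_zero]; ring

variable (r : ℝ) (hr : 0 ≤ r)

/-- THE LABEL-DEPENDENT CAUCHY WEIGHT (toy DATA): `c l := (cM r∕2)·maj l` (W35's `cM` BY NAME). [folklore] -/
def cC (l : LabelC N) : ℝ := cM r / 2 * majC N l
/-- `0 ≤ c l`. [arith] -/
theorem cC_nonneg (l : LabelC N) : 0 ≤ cC N r l := mul_nonneg (half_pos (cM_pos r)).le (majC_nonneg N l)

/-- **THE LABEL-INDEXED CORE FAMILY** (toy DATA): at the outer label `l` W33's one-label core `coreW` (BY NAME) at the weight `c l`. [folklore] -/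
def GC : ∀ (_ : ℕ) (_ : LabelC N), ℕ → BiCore toyFrame (fun _ : Unit => (0 : ℕ)) ℂ Unit E1 :=
  fun _ l _ => coreW (cC N r l) r hr
/-- The core at `(k, l, X)`. [folklore] -/
@[simp] theorem GC_apply (k : ℕ) (l : LabelC N) (X : ℕ) : GC N r hr k l X = coreW (cC N r l) r hr := rfl

/-- THE ACTIVITY OF RECORD (toy DATA): the sum of the label-indexed cores' terms over ALL admissible outer labels, along the pencil
`s ↦ 0 + s • liveTable` (N0w's `hact`∕`hscale` by `rfl`, `emb Z := k`). [folklore] -/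
def actC (k : ℕ) (s : ℂ) (Z : TDom 4 N) : ℂ :=
  ∑ l ∈ termsC N Z, (GC N r hr k l k).termAt (0 : ℂ) ((0 : B13HistM toyFrame) + s • liveTable)

/-- **`hAmp` MET FOR EVERY SUB-POLYMER AND EVERY LABEL** [decided toy], in the LITERAL binder shape of N0w at NE5's toy letters
`(mq, bq, N₀) = (1, 0, 1)`, `ϱ = 2`, `A₀ = 0`, `A₁ = A∕4`: `maj l·|cM r∕2|·√(2π)·e^{r·2‖liveTable‖} ≤ (0 + 2·(A∕4))·maj l`
(W35's `letterMass_coreW`, W41's `budget_half` BY NAME). [folklore] -/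
theorem hAmp_C (k : ℕ) :
    ∀ Z : (tsys 4 N).Dom, (tgeometry 4 N).cubes Z ⊆ (tgeometry 4 N).cubes (X₀ N) → ∀ l ∈ termsC N Z,
      (GC N r hr k l k).lam.real univ *
          ((GC N r hr k l k).wB * (fun (_ : ℕ) (_ : LabelC N) (_ : ℕ) => (1 : ℝ)) k l k *
            Real.exp ((fun (_ : ℕ) (_ : LabelC N) (_ : ℕ) => (0 : ℝ)) k l k)) *
          (Real.pi / ((fun (_ : ℕ) (_ : LabelC N) (_ : ℕ) => (1 : ℝ)) k l k / 2)) ^ (Module.finrank ℝ E1 / 2 : ℝ) *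
        Real.exp ((GC N r hr k l k).N₁ * (‖(0 : B13HistM toyFrame)‖ + 2 * ‖liveTable‖)) ≤
      (0 + 2 * (Acst / 4)) * (vC N ^ l.1.card * ∏ x ∈ l.2.1.attach, (εC N * mC N (l.2.2 x.1 x.2).1 (l.2.2 x.1 x.2).2)) := by
  intro Z _ l _
  simp only [GC_apply]
  rw [letterMass_coreW, N₁_coreW, norm_zero, zero_add]
  have hp : 0 ≤ majC N l := majC_nonneg N l
  have hT : 2 * ‖liveTable‖ ≤ 2 := by linarith [norm_liveTable_le]
  have hb := budget_half r hr hT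
  show |cC N r l| * Real.sqrt (2 * Real.pi) * Real.exp (r * (2 * ‖liveTable‖)) ≤ (0 + 2 * (Acst / 4)) * majC N l
  unfold cC
  rw [abs_mul, abs_of_nonneg hp]
  calc |cM r / 2| * majC N l * Real.sqrt (2 * Real.pi) * Real.exp (r * (2 * ‖liveTable‖))
      = majC N l * (|cM r / 2| * Real.sqrt (2 * Real.pi) * Real.exp (r * (2 * ‖liveTable‖))) := by ring
    _ ≤ majC N l * (Acst / 2) := mul_le_mul_of_nonneg_left hb hp
    _ = (0 + 2 * (Acst / 4)) * majC N l := by ring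

/-! ## §5 THE END FIRES: N0w's anchored-components END applied ONCE BY NAME (a decided applier) -/

open Classical in
/-- **N0w's `attachedPart_locE_le_of_coresAt_pencil_components` FIRES** [decided toy]: both geometries the torus `(tsys 4 N, tgeometry 4 N)`,
closure `cl := id`, anchor `anc₁`, inner data `(univ : Finset Bool, mC)`, cores `GC` indexed by ALL admissible labels, W33's `ctr0`∕`hroom0`,
NE5's toy letters INLINE, the pencil's two radius inequalities, `hscale`∕`hact` by `rfl`, W24's `hrate_torus`, W45's `hsmall_F`∕`hκ_F`,
§1's `hRR_C`∕`hrate2_C`∕`hκR_C`∕`h229_C`, §2's `hanchor_C`∕`hA_C`∕`htransfer_C`∕`hinner_C`, **`hlink := link_torus' 4 N`** (S40.1 BY NAME),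
§3's `hadm_C`, §4's `hAmp_C`, `hϱ : 2 ≤ 2`, `hϱA`.  Conclusion LITERAL. [folklore] -/
theorem componentsEnd_fires (k : ℕ) :
    ‖locE (tgeometry 4 N).ι (tgeometry 4 N).cubes (actC N r hr k 1) ((tgeometry 4 N).cubes (X₀ N)) -
        locE (tgeometry 4 N).ι (tgeometry 4 N).cubes (actC N r hr k 0) ((tgeometry 4 N).cubes (X₀ N))‖ ≤
      4 * (Real.exp 1 * (tgeometry 4 N).ν * (tgeometry 4 N).c₁ * (tgeometry 4 N).K₀ ^ 2) * (Acst / 4) *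
        Real.exp (-(0 * (tsys 4 N).dj (X₀ N))) :=
  attachedPart_locE_le_of_coresAt_pencil_components (tsys 4 N) (tgeometry 4 N) (tgeometry 4 N) (GC N r hr)
    (Win := Set.univ) (ctr := ctr0) (ROp := fun _ => 1) (RHist := fun _ => 2) (R' := fun _ => 2)
    (mq := fun _ _ _ => 1) (bq := fun _ _ _ => 0) (N₀ := fun _ _ _ => 1)
    hroom0 (fun _ _ _ _ _ _ _ => one_pos)
    (fun _ _ _ _ _ _ _ => ⟨fun _ _ => aestronglyMeasurable_const, fun _ => differentiableOn_const _, fun _ _ _ => by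
      show ‖(1 : ℂ)‖ ≤ 1; rw [norm_one]⟩)
    (fun _ _ _ _ _ _ _ => ⟨fun _ _ => (Complex.measurable_ofReal.comp (measurable_snd.norm.pow_const 2)).aestronglyMeasurable,
      fun _ _ => differentiableOn_const _, fun _ _ _ v => by
        show 1 * ‖v‖ ^ 2 - 0 ≤ (((‖v‖ ^ 2 : ℝ) : ℂ)).re; rw [Complex.ofReal_re]; simp⟩)
    (g := fun _ => 0) (Set.mem_univ _) (U := ()) (o := 0) (h₀ := 0) (w := liveTable) (ϱ := 2)
    (by show ‖(0 : ℂ) - 0‖ ≤ 1; simp)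
    (by show ‖(0 : B13HistM toyFrame) - 0‖ + 2 * ‖liveTable‖ ≤ 2; rw [sub_zero, norm_zero, zero_add];
        linarith [norm_liveTable_le])
    (emb := fun _ => k) (fun _ => rfl) (terms := termsC N) (act := actC N r hr k) (fun _ _ _ => rfl)
    (A₀ := 0) (A₁ := Acst / 4) (r₁ := 0) (b₅ := 0) (X₀ := X₀ N)
    le_rfl (by have := Acst_pos; positivity) le_rfl (by norm_num) (hrate_torus N) (hsmall_F N)
    (fun _ => (Finset.univ : Finset Bool)) (mC N) (mC_nonneg N) (fun Z : TDom 4 N => Z) (anc₁ N)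
    (ε := εC N) (c₀ := 0) (R₀ := R₀C N) (Aₐ := 1) (ℓ := 1) (r := δF * κF) (R := RI N) (c' := 5) (v := vC N)
    (εC_pos N).le (vC_pos N).le (hinner_C N) (hanchor_C N) (hA_C N) (htransfer_C N) (hκR_C N) (hrate2_C N) (hκ_F N) (h229_C N)
    (link_torus' 4 N) (hRR_C N) (hadm_C N) (hAmp_C N r hr k) le_rfl (by have := Acst_pos; linarith)

open Classical in
/-- … in CLOSED FORM: `≤ 4·(e·9·64·K₀(64,8)²)·(A∕4) = K₀(64,8)` (pv22's constants by `torus_consts`∕`K₀_four` BY NAME). [folklore] -/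
theorem componentsEnd_fires_closed (k : ℕ) :
    ‖locE (tgeometry 4 N).ι (tgeometry 4 N).cubes (actC N r hr k 1) ((tgeometry 4 N).cubes (X₀ N)) -
        locE (tgeometry 4 N).ι (tgeometry 4 N).cubes (actC N r hr k 0) ((tgeometry 4 N).cubes (X₀ N))‖ ≤ K₀ 64 8 := by
  refine (componentsEnd_fires N r hr k).trans (le_of_eq ?_)
  rw [(torus_consts N).1, (torus_consts N).2.2, K₀_four, zero_mul, neg_zero, Real.exp_zero, mul_one]
  unfold Acst
  have hK := K₀_pos (64 : ℝ) 8
  have he := Real.exp_pos 1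
  field_simp

end Torus

end Summit.QuantumFields.BalabanUV.T4Continuum.NE1p.DressedSmallFieldComponentsWitness

end
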